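import Summits.SmoothPoincare4.SmoothPoincare4.Theorems.ConvexBisectionAcyclicBisectionExistsSplitComplement
import Summits.SmoothPoincare4.SmoothPoincare4.Theorems.ConvexBisectionAcyclicBisectionExistsDualHandleBeltMap
import Literature.Topology.FourManifolds.HandleAttachingMapOfTube
import Literature.Topology.FourManifolds.AttachingMapBoundaryTube
import Literature.Topology.FourManifolds.CollarTheorem
import Literature.Topology.FourManifolds.HandleAttachingMapsTransport
import Literature.Topology.FourManifolds.PresentationHandlebodyFiveProofs
import Literature.Geometry.Symplectic.TwoHandleIsotopyHolds
import HarnessLib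

/-!
# DESIGN SKELETON — NF6 sub-goal T3: the complement piece `W₂` of a sorted fibred model is the
# cap `Base g` with the DUAL handles, a Lefschetz handlebody of the dual word
(design file of brief W3, wave 1, lead c5; crux `ConvexBisection.AcyclicBisectionExists`, item
stmt-SmoothPoincare4-10508, line `modp-braid-orbits` r11, parent stub `stub_steinRealisation` (NF6)).
`lean check`: rc 0; `sorry` ONLY in the theorems named `node_*`.  This file is evidence, not a
Theorems file.

## The chain (Baykur 2006, proof of Thm. 5.1, p. 13: "`M = X₊ ∪ (the rest)`, the rest being `−X₋`, a
## PALF"; Milnor 1965 §3 / Kosinski 1993 VII §1: dual handles; Gompf–Stipsicz 1999 §8.2 pp. 289–291)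

Data: `hM : ModelsOnFibred M g (P ++ N)` = `M = X ∪_Ψ Base g`, `X = Base g ∪_{h̄} (handles)` with data
`D`, `Ψ : ∂X ≅ ∂ Base g` page-preserving on the base part of the seam.  Write `m = |P|`, `n = |N|`.

* **T3a-1 (LANDED, p134491 + p134936)** `beltMap D j : HandleAttachingMap 3 2 X` — the belt tube
  `D.jB j ∘ σ` of the `j`-th handle (block swap `σ (x_λ, x_μ) = (x_μ, x_λ)`), attaching circle = belt
  circle `D.jB j (0, 0, θ)`.
* **§0 plumbing (proved here)**: `CircleTube.mapDiffeo` (push a tube in a 3-manifold through a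
  diffeomorphism), `seamDiffeo bX bW Ψ : ∂X ≅ ∂W` (canonical boundary carriers), `pushedTubeData`,
  **`pushedMap q₀ G col κ δ : HandleAttachingMap 3 2 W`** = the boundary tube of `q₀` pushed through
  `G : ∂X ≅ ∂W` and prolonged along the collar `col` of `∂W` (`TubeAttachData.attachingMap`), its
  attaching circle (`attachingCircle_pushedMap`); **`dualMap D bX bW Ψ col κ δ j`** := `pushedMap` of
  `beltMap D j` through `seamDiffeo` — THE DUAL ATTACHING MAP of handle `j` on the cap; `dualWord`,
  `IsLefschetzLinkAt` (a Lefschetz link at arbitrary page directions), `ClockwiseDirs`.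
* **node T3a/T3b `node_dual_presentation` (XL, ≈ 2000–3000 lines)**: `M = X₁ ∪_φ W₂` with
  `X₁ = B ∪ (prefix handles)` (data `D₁`, as in `helper_isMultiAttachment_split_append`), `X = X₁ ∪
  (suffix)`, and `W₂ = W ∪_{dualMap} (n handles)` (data `D₂`), the seam `φ` agreeing with `Ψ` off the
  suffix tubes.  One-handle form `node_dual_presentation_one` (T3a) is its instance.
* **node T3c-1 `node_belt_isotopic_pushoff` (L, ≈ 800–1500)**: in `∂X`, the framed belt knot of a
  Lefschetz handle attached along `K_j ⊂ page c_j` is framed-isotopic (as a link, through `∂X`) to the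
  `jA`-image of a push-off `K♯_j ⊂ page (c_j e^{-iη})` with a framing of page twisting `σ₀ t_j`,
  `σ₀ = ±1` universal (expected `σ₀ = −1`: the cocore is attached from the other side), same shadow.
* **node T3c-2 `node_seam_transport` (L, ≈ 1000–1500)**: the page clause makes `Ψ ∘ jA` fibred on the
  base part of the seam; a framed page knot off the cores goes to a framed knot in the EXTENDED page
  `{arg w = arg c}` of `∂ Base g`, fibred-isotopic (radial flow in the binding region) to a framed knot
  in `page g c` with shadow `A(shadow)` for an automorphism `A` of `ℤ^{2g}` (the fibre identification
  of `Ψ`, which jumps by Picard–Lefschetz twists across critical angles — hence one `A j` per letter)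
  and page twisting multiplied by a GLOBAL sign `s₀ = ±1` (the orientation character of `Ψ ∘ jA`).
* **node T3c-3 `node_dualLink_pageLink` (M, ≈ 500–800 on top of T3c-1/2)**: ISO
  (`isMultiAttachment_of_linkIsotopyInBoundary_holds`, PROVED) + TUBE
  (`exists_handleAttachingMap_of_isKnotFraming_holds`, PROVED): any multi-attachment along the dual maps
  is a multi-attachment along a Lefschetz link AT the directions `dir j = pageDir (m+n) (m+j) e^{-iη}`
  realising `dualWord N A flip`.
* **node T3c-4 `node_pageRotation_of_clockwiseDirs` (L; W1's `helper_exists_pageRotation` is the special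
  case `dir = pageDir (m+n) ∘ (· < m)`, same proof)** and **node T3c-5 `node_isLefschetzLink_transport_at`
  (S, ≈ 250; W2's `helper_isLefschetzLink_prefix_transport` is the special case)**.
* **TARGET `isLefschetzHandlebody_complement_of_nodes` — PROVED below from the nodes**:
  from `ModelsOnFibred M g (P ++ N)`: the link `h`, `X₁` with prefix data `D₁` (shape of
  `helper_exists_complement_of_split`, so T1 plugs in), a compact `W₂`, `b₂`, `φ` with
  `IsBoundaryGluing (∂X₁) b₂ φ (𝓡 4) M`, AND `IsLefschetzHandlebody g (dualWord N A flip) W₂` for SOME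
  letterwise automorphisms `A` and SOME `flip : Bool`.

## FINDING (for the lead; why the target is NOT `IsLefschetzHandlebody g (mirrorWord N) W₂` for a FORMULA)

`ModelsOnFibred` constrains `Ψ` only through page ANGLES (`w (Ψ y) ∈ ℝ_{>0} w a`).  Composing a valid
`Ψ` with `∂R` for any page-preserving self-diffeomorphism `R` of `Base g` (e.g. `τ × id` for a mapping
class `τ` of the page, or an orientation-REVERSING fibred `R`) gives another valid witness of
`ModelsOnFibred M g l` for the SAME `M` (the cap absorbs `R`).  Hence neither the classes of the dual
vanishing cycles (they are `A_j (N_j)` with `A_j ∈ GL(ℤ^{2g})` = fibre identification of `Ψ` at the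
`j`-th suffix angle, arbitrary) nor their chirality w.r.t. the cap's complex orientation (the dual
twisting is `ε · t`, `ε = ±1` the orientation character of `Ψ ∘ jA`, arbitrary) is determined by the
hypothesis; complex conjugation `(x, y) ↦ (x̄, ȳ)` is orientation-PRESERVING on `ℂ²` and cannot repair
the sign.  What IS provable and suffices for NF6: the dual word has letterwise-transformed non-zero
classes and UNIFORMLY transformed signs (`flip`), so for `N` all-negative the dual word is all-positive
or all-negative; the all-negative case is turned positive only by an orientation-reversing fibred
self-diffeomorphism of `Base g` (not algebraic: no (anti)holomorphic candidate; ≈ T1-size) or by filing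
S2 (PALF ⇒ Stein) sign-symmetrically.  See `W3-REPORT.md`.
-/

noncomputable section

set_option linter.dupNamespace false
set_option linter.unusedVariables false

open scoped Manifold ContDiff Topology

namespace Summit.SmoothPoincare4.SmoothPoincare4.Theorems.AcyclicBisectionExists.ModpBraidOrbits

open Set Function Filter Metric Topology
open Literature.Topology.FourManifolds Literature.Topology.FourManifolds.HandleAttachingMap
  Literature.Topology.FourManifolds.LefschetzBase Literature.Geometry.Symplectic

attribute [local instance] fact_finrank_euclideanSpace_succ

/-! ## §0 Plumbing (everything in this section is PROVED) -/

section Plumbing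

/-! ### §0.1 Pushing a tube through a diffeomorphism of 3-manifolds -/

/-- **A tube around a circle pushed through a diffeomorphism of 3-manifolds**: `G ∘ Φ`.
[cite: Kosinski1993, III (3.1)] -/
def _root_.Literature.Topology.FourManifolds.CircleTube.mapDiffeo
    {Y Y' : Type*} [TopologicalSpace Y] [ChartedSpace (EuclideanSpace ℝ (Fin 3)) Y]
    [TopologicalSpace Y'] [ChartedSpace (EuclideanSpace ℝ (Fin 3)) Y']
    (Φ : CircleTube Y) (G : Y ≃ₘ⟮𝓡 3, 𝓡 3⟯ Y') : CircleTube Y' where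
  toHomeo := Φ.toHomeo.transHomeomorph G.toHomeomorph
  source_eq := by rw [OpenPartialHomeomorph.transHomeomorph_source, Φ.source_eq]
  contMDiffOn_toHomeo := by
    rw [OpenPartialHomeomorph.transHomeomorph_source, OpenPartialHomeomorph.transHomeomorph_apply]
    exact G.contMDiff.comp_contMDiffOn Φ.contMDiffOn_toHomeo
  contMDiffOn_symm := by
    rw [OpenPartialHomeomorph.transHomeomorph_target, OpenPartialHomeomorph.transHomeomorph_symm_apply]
    exact Φ.contMDiffOn_symm.comp G.symm.contMDiff.contMDiffOn fun _ hp => hp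

/-- The pushed tube on points. [folklore] -/
@[simp] theorem _root_.Literature.Topology.FourManifolds.CircleTube.mapDiffeo_apply
    {Y Y' : Type*} [TopologicalSpace Y] [ChartedSpace (EuclideanSpace ℝ (Fin 3)) Y]
    [TopologicalSpace Y'] [ChartedSpace (EuclideanSpace ℝ (Fin 3)) Y']
    (Φ : CircleTube Y) (G : Y ≃ₘ⟮𝓡 3, 𝓡 3⟯ Y') (q : (sphere (0 : EuclideanSpace ℝ (Fin 2)) 1) × EuclideanSpace ℝ (Fin 2)) :
    (Φ.mapDiffeo G).toHomeo q = G (Φ.toHomeo q) := by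
  show (Φ.toHomeo.transHomeomorph G.toHomeomorph) q = _
  rw [OpenPartialHomeomorph.transHomeomorph_apply]; rfl

/-- The source of the pushed tube. [folklore] -/
theorem _root_.Literature.Topology.FourManifolds.CircleTube.mapDiffeo_source
    {Y Y' : Type*} [TopologicalSpace Y] [ChartedSpace (EuclideanSpace ℝ (Fin 3)) Y]
    [TopologicalSpace Y'] [ChartedSpace (EuclideanSpace ℝ (Fin 3)) Y']
    (Φ : CircleTube Y) (G : Y ≃ₘ⟮𝓡 3, 𝓡 3⟯ Y') : (Φ.mapDiffeo G).toHomeo.source = Φ.toHomeo.source :=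
  OpenPartialHomeomorph.transHomeomorph_source _ _

/-! ### §0.2 The seam diffeomorphism on the canonical boundary carriers -/

variable {X : Type} [TopologicalSpace X] [ChartedSpace (EuclideanHalfSpace 4) X] [IsManifold (𝓡∂ 4) ∞ X]
  {W : Type} [TopologicalSpace W] [ChartedSpace (EuclideanHalfSpace 4) W] [IsManifold (𝓡∂ 4) ∞ W]

/-- **The seam diffeomorphism `∂X ≅ ∂W` on the CANONICAL boundary carriers** (the subtypes
`(𝓡∂ 4).boundary X`, `(𝓡∂ 4).boundary W` of `BoundaryManifold.boundaryData`), obtained from a gluing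
diffeomorphism `Ψ : bX.carrier ≅ bW.carrier` between arbitrary boundary data by restricting the identity
(`BoundaryData.restrictDiffeomorph`, Lee 2013 Thm. 5.11). [cite: LeeSmoothManifolds2013, Thm. 5.11] -/
def seamDiffeo (bX : BoundaryData (𝓡∂ 4) X (𝓡 3)) (bW : BoundaryData (𝓡∂ 4) W (𝓡 3))
    (Ψ : bX.carrier ≃ₘ⟮𝓡 3, 𝓡 3⟯ bW.carrier) :
    (BoundaryManifold.boundaryData 3 X).carrier ≃ₘ⟮𝓡 3, 𝓡 3⟯ (BoundaryManifold.boundaryData 3 W).carrier :=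
  (((BoundaryManifold.boundaryData 3 X).restrictDiffeomorph bX (Diffeomorph.refl (𝓡∂ 4) X ∞)).trans Ψ).trans
    (bW.restrictDiffeomorph (BoundaryManifold.boundaryData 3 W) (Diffeomorph.refl (𝓡∂ 4) W ∞))

/-- **The seam diffeomorphism on points**: `seamDiffeo y = bW.incl (Ψ z)` for the `z` with
`bX.incl z = y`. [folklore] -/
theorem coe_seamDiffeo (bX : BoundaryData (𝓡∂ 4) X (𝓡 3)) (bW : BoundaryData (𝓡∂ 4) W (𝓡 3))
    (Ψ : bX.carrier ≃ₘ⟮𝓡 3, 𝓡 3⟯ bW.carrier) (y : (BoundaryManifold.boundaryData 3 X).carrier) :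
    (BoundaryManifold.boundaryData 3 W).incl (seamDiffeo bX bW Ψ y) =
      bW.incl (Ψ ((BoundaryManifold.boundaryData 3 X).restrictDiffeomorph bX (Diffeomorph.refl (𝓡∂ 4) X ∞) y)) := by
  show (BoundaryManifold.boundaryData 3 W).incl
      (bW.restrictDiffeomorph (BoundaryManifold.boundaryData 3 W) (Diffeomorph.refl (𝓡∂ 4) W ∞) (Ψ _)) = _
  rw [BoundaryData.incl_restrictDiffeomorph]
  rfl

/-- The restriction of the identity relates the two boundary inclusions: `bX.incl (∂(id) y) = y`.
[folklore] -/
theorem incl_restrict_refl (bX : BoundaryData (𝓡∂ 4) X (𝓡 3)) (y : (BoundaryManifold.boundaryData 3 X).carrier) :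
    bX.incl ((BoundaryManifold.boundaryData 3 X).restrictDiffeomorph bX (Diffeomorph.refl (𝓡∂ 4) X ∞) y) =
      (BoundaryManifold.boundaryData 3 X).incl y := by
  rw [BoundaryData.incl_restrictDiffeomorph]; rfl

/-! ### §0.3 An attaching map pushed through a boundary diffeomorphism and re-prolonged along a collar -/

/-- **Data for the pushed attaching map**: the boundary tube of `q₀ : T → X` (`q₀.boundaryTube`, a
tube in `∂X`) pushed through `G : ∂X ≅ ∂W`, a collar of `∂W`, and scales `0 < κ ≤ 1`, `0 < δ ≤ 1/2`.
[cite: Kosinski1993, III §4 and VI §6] -/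
def pushedTubeData (q₀ : HandleAttachingMap 3 2 X)
    (G : (BoundaryManifold.boundaryData 3 X).carrier ≃ₘ⟮𝓡 3, 𝓡 3⟯ (BoundaryManifold.boundaryData 3 W).carrier)
    (col : (BoundaryManifold.boundaryData 3 W).Collar) (κ δ : ℝ) (hκ : 0 < κ) (hκ1 : κ ≤ 1) (hδ : 0 < δ)
    (hδ2 : δ ≤ 1 / 2) : TubeAttachData W where
  tube := (q₀.boundaryTube.mapDiffeo G).toHomeo
  ε := 1
  source_eq := (q₀.boundaryTube.mapDiffeo G).source_eq
  smooth := (q₀.boundaryTube.mapDiffeo G).contMDiffOn_toHomeo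
  smooth_symm := (q₀.boundaryTube.mapDiffeo G).contMDiffOn_symm
  col := col
  κ := κ
  δ := δ
  κ_pos := hκ
  κ_le := hκ1
  δ_pos := hδ
  δ_le := hδ2

/-- **The pushed attaching map** `W ⊇ col (G (q₀-tube of ∂X), height)`: the boundary germ of `q₀`
transplanted to `W` through `G : ∂X ≅ ∂W` (`TubeAttachData.attachingMap`: a smooth embedding `T → W`
with open range sending `T ∩ ∂D⁴` into `∂W`). [cite: Kosinski1993, III §4 and VI §6] -/
def pushedMap (q₀ : HandleAttachingMap 3 2 X)
    (G : (BoundaryManifold.boundaryData 3 X).carrier ≃ₘ⟮𝓡 3, 𝓡 3⟯ (BoundaryManifold.boundaryData 3 W).carrier)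
    (col : (BoundaryManifold.boundaryData 3 W).Collar) (κ δ : ℝ) (hκ : 0 < κ) (hκ1 : κ ≤ 1) (hδ : 0 < δ)
    (hδ2 : δ ≤ 1 / 2) : HandleAttachingMap 3 2 W :=
  (pushedTubeData q₀ G col κ δ hκ hκ1 hδ hδ2).attachingMap

/-- **The attaching circle of the pushed map is `G` of the attaching circle of `q₀`.**
[cite: Kosinski1993, VI §6] -/
theorem attachingCircle_pushedMap (q₀ : HandleAttachingMap 3 2 X)
    (G : (BoundaryManifold.boundaryData 3 X).carrier ≃ₘ⟮𝓡 3, 𝓡 3⟯ (BoundaryManifold.boundaryData 3 W).carrier)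
    (col : (BoundaryManifold.boundaryData 3 W).Collar) (κ δ : ℝ) (hκ : 0 < κ) (hκ1 : κ ≤ 1) (hδ : 0 < δ)
    (hδ2 : δ ≤ 1 / 2) (θ : sphere (0 : EuclideanSpace ℝ (Fin 2)) 1) :
    (pushedMap q₀ G col κ δ hκ hκ1 hδ hδ2).attachingCircle θ =
      (BoundaryManifold.boundaryData 3 W).incl
        (G (⟨q₀.attachingCircle θ, q₀.isBoundaryPoint_attachingCircle θ⟩ : ↥((𝓡∂ 4).boundary X))) := by
  rw [pushedMap, TubeAttachData.attachingCircle_attachingMap]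
  show (BoundaryManifold.boundaryData 3 W).incl ((q₀.boundaryTube.mapDiffeo G).toHomeo (θ, 0)) = _
  rw [CircleTube.mapDiffeo_apply]
  congr 2
  apply Subtype.ext
  exact q₀.coe_boundaryTube_core θ

/-! ### §0.4 The dual attaching maps of a multi-attachment glued to `W` -/

variable {B : Type} [TopologicalSpace B] [T2Space B] [ChartedSpace (EuclideanHalfSpace 4) B]
  {ι : Type} [Finite ι] {h : ι → HandleAttachingMap 3 2 B}

/-- **THE DUAL ATTACHING MAP of the `j`-th handle of `X = B ∪_{h̄} (handles)` on the other piece `W`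
of a gluing `M = X ∪_Ψ W`**: the belt tube of the handle (`beltMap D j`, landed p134936) read in `∂X`,
pushed through the seam diffeomorphism `Ψ` and prolonged along the collar `col` of `∂W` (Milnor 1965
§3: the dual handle is attached along the image of the belt sphere; Kosinski 1993 VI §6: attaching
map = tubular neighbourhood in the boundary prolonged by a collar). [cite: MilnorHCobordism1965, §3] -/
def dualMap (D : MultiAttachmentData h (𝓡∂ 4) X) (bX : BoundaryData (𝓡∂ 4) X (𝓡 3))
    (bW : BoundaryData (𝓡∂ 4) W (𝓡 3)) (Ψ : bX.carrier ≃ₘ⟮𝓡 3, 𝓡 3⟯ bW.carrier)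
    (col : (BoundaryManifold.boundaryData 3 W).Collar) (κ δ : ℝ) (hκ : 0 < κ) (hκ1 : κ ≤ 1) (hδ : 0 < δ)
    (hδ2 : δ ≤ 1 / 2) (j : ι) : HandleAttachingMap 3 2 W :=
  pushedMap (beltMap D j) (seamDiffeo bX bW Ψ) col κ δ hκ hκ1 hδ hδ2

/-- **The dual attaching circle is `Ψ` of the belt circle**: for the `z` with
`bX.incl z = D.jB j (0, 0, θ)`, `(dualMap … j).attachingCircle θ = bW.incl (Ψ z)`.
[cite: MilnorHCobordism1965, §3] -/
theorem attachingCircle_dualMap (D : MultiAttachmentData h (𝓡∂ 4) X) (bX : BoundaryData (𝓡∂ 4) X (𝓡 3))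
    (bW : BoundaryData (𝓡∂ 4) W (𝓡 3)) (Ψ : bX.carrier ≃ₘ⟮𝓡 3, 𝓡 3⟯ bW.carrier)
    (col : (BoundaryManifold.boundaryData 3 W).Collar) (κ δ : ℝ) (hκ : 0 < κ) (hκ1 : κ ≤ 1) (hδ : 0 < δ)
    (hδ2 : δ ≤ 1 / 2) (j : ι) (θ : sphere (0 : EuclideanSpace ℝ (Fin 2)) 1) :
    ∃ z : bX.carrier, bX.incl z = D.jB j (beltCirclePt θ) ∧
      (dualMap D bX bW Ψ col κ δ hκ hκ1 hδ hδ2 j).attachingCircle θ = bW.incl (Ψ z) := by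
  refine ⟨(BoundaryManifold.boundaryData 3 X).restrictDiffeomorph bX (Diffeomorph.refl (𝓡∂ 4) X ∞)
    (⟨(beltMap D j).attachingCircle θ, (beltMap D j).isBoundaryPoint_attachingCircle θ⟩ :
      ↥((𝓡∂ 4).boundary X)), ?_, ?_⟩
  · rw [incl_restrict_refl]; rfl
  · rw [dualMap, attachingCircle_pushedMap, coe_seamDiffeo]

/-- **The old seam, off the belt circles, lies off the dual cores**: if `D.jA a = bX.incl z` then
`bW.incl (Ψ z)` is not on any dual attaching circle (the dual attaching circles are `Ψ` of the belt
circles, `attachingCircle_dualMap`, and belt-circle points are glued to nothing,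
`jA_ne_jB_beltCirclePt`). [cite: Kosinski1993, VI §6] -/
theorem incl_mem_coresComplement_dualMap [T2Space W] (D : MultiAttachmentData h (𝓡∂ 4) X)
    (bX : BoundaryData (𝓡∂ 4) X (𝓡 3)) (bW : BoundaryData (𝓡∂ 4) W (𝓡 3))
    (Ψ : bX.carrier ≃ₘ⟮𝓡 3, 𝓡 3⟯ bW.carrier) (col : (BoundaryManifold.boundaryData 3 W).Collar)
    (κ δ : ℝ) (hκ : 0 < κ) (hκ1 : κ ≤ 1) (hδ : 0 < δ) (hδ2 : δ ≤ 1 / 2)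
    {ι' : Type} [Finite ι'] (f : ι' → ι) (z : bX.carrier) (a : ↥(coresComplement h))
    (hz : D.jA a = bX.incl z) :
    bW.incl (Ψ z) ∈ coresComplement (fun j : ι' => dualMap D bX bW Ψ col κ δ hκ hκ1 hδ hδ2 (f j)) := by
  rw [mem_coresComplement]
  intro j hj
  rw [← range_attachingCircle] at hj
  obtain ⟨θ, hθ⟩ := hj
  obtain ⟨z', hz', hcirc⟩ := attachingCircle_dualMap D bX bW Ψ col κ δ hκ hκ1 hδ hδ2 (f j) θ
  rw [hcirc] at hθ
  have hzz : z' = z := Ψ.injective (bW.injective_incl hθ)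
  subst hzz
  exact jA_ne_jB_beltCirclePt D (f j) a θ (hz.trans hz')

/-- The prefix/suffix attaching maps of a multi-attachment have disjoint ranges (bookkeeping for
`MultiAttachmentData.lift`; indices as in `helper_isMultiAttachment_split_append`). [folklore] -/
theorem disjoint_range_natAdd_castAdd {m n k : ℕ} (hk : k = m + n) {h : Fin k → HandleAttachingMap 3 2 B}
    {P₀ : Type*} [TopologicalSpace P₀] [ChartedSpace (EuclideanHalfSpace 4) P₀]
    (D : MultiAttachmentData h (𝓡∂ 4) P₀) (j : Fin n) (i : Fin m) :
    Disjoint (range (h (Fin.cast hk.symm (Fin.natAdd m j))).toFun)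
      (range (h (Fin.cast hk.symm (Fin.castAdd n i))).toFun) :=
  D.disjoint fun e => by
    have := congrArg Fin.val e
    simp at this
    omega

/-! ### §0.5 Words, links at arbitrary directions -/

/-- **The dual word**: letterwise, the class pushed through an automorphism `A j` of `ℤ^{2g}` and the
sign flipped iff `flip` (uniformly).  For `N` all-negative and `flip = true` this is the positive word
`Ā(N̄)` of Baykur's `−X₋`. [cite: Baykur2006, Thm. 5.1 (proof, p. 13)] -/
def dualWord {g : ℕ} (N : List ((Fin g ⊕ Fin g → ℤ) × Bool))
    (A : Fin N.length → ((Fin g ⊕ Fin g → ℤ) ≃ₗ[ℤ] (Fin g ⊕ Fin g → ℤ))) (flip : Bool) :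
    List ((Fin g ⊕ Fin g → ℤ) × Bool) :=
  List.ofFn fun j : Fin N.length => (A j (N.get j).1, xor flip (N.get j).2)

/-- The dual word has the length of the word. [folklore] -/
@[simp] theorem length_dualWord {g : ℕ} (N : List ((Fin g ⊕ Fin g → ℤ) × Bool))
    (A : Fin N.length → ((Fin g ⊕ Fin g → ℤ) ≃ₗ[ℤ] (Fin g ⊕ Fin g → ℤ))) (flip : Bool) :
    (dualWord N A flip).length = N.length := by
  simp [dualWord]

/-- The letters of the dual word. [folklore] -/
theorem get_dualWord {g : ℕ} (N : List ((Fin g ⊕ Fin g → ℤ) × Bool))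
    (A : Fin N.length → ((Fin g ⊕ Fin g → ℤ) ≃ₗ[ℤ] (Fin g ⊕ Fin g → ℤ))) (flip : Bool)
    (j : Fin (dualWord N A flip).length) :
    (dualWord N A flip).get j =
      (A (Fin.cast (length_dualWord N A flip) j) (N.get (Fin.cast (length_dualWord N A flip) j)).1,
        xor flip (N.get (Fin.cast (length_dualWord N A flip) j)).2) := by
  simp [dualWord]
  rfl

/-- **The classes of the dual word are non-zero if those of the word are** (automorphisms are
injective). [folklore] -/
theorem dualWord_forall_ne_zero {g : ℕ} (N : List ((Fin g ⊕ Fin g → ℤ) × Bool))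
    (A : Fin N.length → ((Fin g ⊕ Fin g → ℤ) ≃ₗ[ℤ] (Fin g ⊕ Fin g → ℤ))) (flip : Bool)
    (hN : ∀ x ∈ N, x.1 ≠ 0) : ∀ x ∈ dualWord N A flip, x.1 ≠ 0 := by
  intro x hx
  obtain ⟨j, rfl⟩ := List.mem_iff_get.1 hx
  rw [get_dualWord]
  intro h0
  exact hN _ (List.get_mem N _) ((A _).map_eq_zero_iff.1 h0)

/-- **The signs of the dual word are uniform on a uniformly signed word**: if all letters of `N` have
sign `b` then all letters of the dual word have sign `xor flip b`. [folklore] -/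
theorem dualWord_forall_sign {g : ℕ} (N : List ((Fin g ⊕ Fin g → ℤ) × Bool))
    (A : Fin N.length → ((Fin g ⊕ Fin g → ℤ) ≃ₗ[ℤ] (Fin g ⊕ Fin g → ℤ))) (flip b : Bool)
    (hN : ∀ x ∈ N, x.2 = b) : ∀ x ∈ dualWord N A flip, x.2 = xor flip b := by
  intro x hx
  obtain ⟨j, rfl⟩ := List.mem_iff_get.1 hx
  rw [get_dualWord, hN _ (List.get_mem N _)]

/-- **A Lefschetz link AT the page directions `dir`**: the clauses of `IsLefschetzLink g l h` with the
standard directions `pageDir |l| i` replaced by arbitrary unit complex numbers `dir i` (the shape in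
which the dual link arises, before the page rotation). [cite: EtnyreFuller2006, §2] -/
structure IsLefschetzLinkAt (g : ℕ) (l : List ((Fin g ⊕ Fin g → ℤ) × Bool)) (dir : Fin l.length → ℂ)
    (h : Fin l.length → HandleAttachingMap 3 2 (Base g)) : Prop where
  /-- the directions are unit complex numbers -/
  norm_dir : ∀ i, ‖dir i‖ = 1
  /-- pairwise disjoint ranges -/
  disjoint : Pairwise fun i j => Disjoint (range (h i).toFun) (range (h j).toFun)
  /-- the `i`-th circle lies in the page of direction `dir i` -/
  mem_page : ∀ (i : Fin l.length) θ, (h i).attachingCircle θ ∈ page g (dir i)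
  /-- shadows -/
  shadow_eq : ∀ i, shadow g (h i).attachingCircle (h i).continuous_attachingCircle = (l.get i).1
  /-- page twistings -/
  twisting_eq : ∀ i,
    pageTwisting g (h i).attachingCircle (h i).attachingFraming = if (l.get i).2 then -1 else 1

/-- A Lefschetz link is a Lefschetz link at the standard directions. [folklore] -/
theorem IsLefschetzLink.at {g : ℕ} {l : List ((Fin g ⊕ Fin g → ℤ) × Bool)}
    {h : Fin l.length → HandleAttachingMap 3 2 (Base g)} (hl : IsLefschetzLink g l h) :
    IsLefschetzLinkAt g l (fun i => pageDir l.length i) h :=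
  ⟨fun i => norm_pageDir _ _, hl.disjoint, hl.mem_page, hl.shadow_eq, hl.twisting_eq⟩

/-- A Lefschetz link at the standard directions is a Lefschetz link. [folklore] -/
theorem IsLefschetzLinkAt.isLefschetzLink {g : ℕ} {l : List ((Fin g ⊕ Fin g → ℤ) × Bool)}
    {h : Fin l.length → HandleAttachingMap 3 2 (Base g)}
    (hl : IsLefschetzLinkAt g l (fun i => pageDir l.length i) h) : IsLefschetzLink g l h :=
  ⟨hl.disjoint, hl.mem_page, hl.shadow_eq, hl.twisting_eq⟩

/-- **Clockwise-ordered directions**: `dir i = e^{iα_i}` with `α` strictly decreasing in `i` and of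
total spread `< 2π` (the cyclic order of `pageDir n i`, `i = 0, …, n-1`; the hypothesis under which a
page rotation of the base can carry `dir i` to `pageDir n i`). [folklore] -/
def ClockwiseDirs {n : ℕ} (dir : Fin n → ℂ) : Prop :=
  ∃ α : Fin n → ℝ, StrictAnti α ∧ (∀ i j, α i - α j < 2 * Real.pi) ∧
    ∀ i, dir i = Complex.exp ((α i : ℂ) * Complex.I)

end Plumbing

/-! ## §1 Node T3a/T3b — the dual presentation of the complement piece (XL) -/

section DualPresentation

/-- **NODE T3b (`node_dual_presentation`) — the complement of the prefix sub-handlebody is the other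
piece with the DUAL suffix handles.**  Let `X = B ∪_{h̄} (k = m + n handles)` (data `D`) be glued to a
compact `W` along `Ψ : ∂X ≅ ∂W` into the closed `M`.  Then there are: `X₁ = B ∪ (the m prefix
handles)` (compact, data `D₁`; and `X` is `X₁` with the lifted suffix handles attached — exactly the
output of `helper_isMultiAttachment_split_append`, same index expressions), a collar `col` of `∂W` and
scales, a compact `W₂` which IS `W` with `n` 2-handles attached along the dual maps
`dualMap D bX bW Ψ col κ δ (suffix j)` (data `D₂`), a boundary datum `b₂` of `W₂` and `φ : ∂X₁ ≅ ∂W₂`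
with `M = X₁ ∪_φ W₂`; and the new seam agrees with the old one off the suffix tubes: a point `y ∈ ∂X₁`
coming from a base boundary point `a` off all cores and off the ranges of the suffix attaching maps is
glued by `φ` to the point `D₂.jA (bW.incl (Ψ z))` of `W ⊆ W₂`, where `D.jA a = bX.incl z` (the point
`bW.incl (Ψ z)` is off the dual cores = `Ψ`(belt circles): `incl_mem_coresComplement_dualMap`, PROVED
from `attachingCircle_dualMap` and `jA_ne_jB_beltCirclePt`).
Informal proof (Milnor 1965 §3 "dual presentation"; Kosinski 1993 VI §8, VII §1; GS 1999 §8.2):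
`M ∖ X₁° = (∂X₁ × I ∪ suffix handles) ∪_Ψ W`; the elementary cobordism read upside down is
`∂X × I ∪ (handles attached along the belt spheres)`, and `W ∪ (∂W × I) ≅ W` by the collar.
Formal route: (i) `X₁`, `D₁` and the suffix presentation by the landed split
(`exists_split_castAdd_natAdd` / `helper_isMultiAttachment_split_append`) together with a COMPATIBLE
uniqueness diffeomorphism (re-prove `IsMultiAttachment.nonempty_diffeomorph` exporting `G ∘ jA = jA'`,
`G ∘ jB i = jB' i` — the proof already builds `G` that way —, ≈ 60 lines); (ii) embed `X₁` into `M` by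
`jX ∘ jA ∘ sh` with `sh` a collar push of `X₁` into itself SUPPORTED INSIDE THE SUFFIX TUBES
(`CollarShrink` with a cut-off, as in `…SplitComplementPushforward.lean`; the tubes `h̄ⱼ(T)` are open
neighbourhoods of the cores in `X₁`), so the seam is unchanged off the tubes; (iii) `W₂ :=` the closure
of the complement, a regular sublevel set as in T2 (`isRegularLevel_pushB`,
`RegularSublevel.isBoundaryGluing_split`, `IsBoundaryGluing.transfer`); (iv) the multi-attachment data
of `W₂` along the dual maps — THE LONG POLE (≈ 1200 lines): `D₂.jA` = the gluing embedding `jW` of `W`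
(restricted off the dual cores), `D₂.jB j` = `jX ∘ D.jB (suffix j)` precomposed with the model
diffeomorphism of `D⁴ ∖ S` which matches Kosinski's identification `x ∼ σ(…) α(x)` near the belt tube
with the collar coordinate of `col` and the height `pushB` ("attachment ⇔ elementary cobordism",
`CobordismAttachment.lean` style), then cover / glue / disjointness; (v) `b₂`, `φ`, gluing as in T2.
Independence of `(col, κ, δ)`: all choices give the same dual attaching circles
(`attachingCircle_dualMap`) and proportional framings (`TubeAttachData.attachingMap_tubeArcPt`), so ISO
moves between them; the node asserts SOME choice.  Size XL (≈ 2000–3000 lines, 6–8 files).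
[cite: MilnorHCobordism1965, §3; Kosinski1993, VI §8 and VII §1; GompfStipsicz1999, §8.2 pp. 289–291] -/
theorem node_dual_presentation
    {B : Type} [TopologicalSpace B] [T2Space B] [SecondCountableTopology B] [CompactSpace B]
    [ChartedSpace (EuclideanHalfSpace 4) B] [IsManifold (𝓡∂ 4) ∞ B]
    (m n : ℕ) {k : ℕ} (hk : k = m + n) (h : Fin k → HandleAttachingMap 3 2 B)
    {X : Type} [TopologicalSpace X] [T2Space X] [SecondCountableTopology X] [CompactSpace X]
    [ChartedSpace (EuclideanHalfSpace 4) X] [IsManifold (𝓡∂ 4) ∞ X]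
    (D : MultiAttachmentData h (𝓡∂ 4) X)
    {W : Type} [TopologicalSpace W] [T2Space W] [SecondCountableTopology W] [CompactSpace W]
    [ChartedSpace (EuclideanHalfSpace 4) W] [IsManifold (𝓡∂ 4) ∞ W]
    (bX : BoundaryData (𝓡∂ 4) X (𝓡 3)) (bW : BoundaryData (𝓡∂ 4) W (𝓡 3))
    (Ψ : bX.carrier ≃ₘ⟮𝓡 3, 𝓡 3⟯ bW.carrier)
    {M : Type} [TopologicalSpace M] [T2Space M] [SecondCountableTopology M]
    [ChartedSpace (EuclideanSpace ℝ (Fin 4)) M] [IsManifold (𝓡 4) ∞ M]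
    (hglue : IsBoundaryGluing bX bW Ψ (𝓡 4) M) (hne : ((𝓡∂ 4).boundary B).Nonempty) :
    ∃ (X₁ : Type) (_ : TopologicalSpace X₁) (_ : T2Space X₁) (_ : SecondCountableTopology X₁)
      (_ : CompactSpace X₁) (_ : ChartedSpace (EuclideanHalfSpace 4) X₁) (_ : IsManifold (𝓡∂ 4) ∞ X₁)
      (D₁ : MultiAttachmentData (fun i : Fin m => h (Fin.cast hk.symm (Fin.castAdd n i))) (𝓡∂ 4) X₁)
      (col : (BoundaryManifold.boundaryData 3 W).Collar) (κ δ : ℝ) (hκ : 0 < κ) (hκ1 : κ ≤ 1)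
      (hδ : 0 < δ) (hδ2 : δ ≤ 1 / 2)
      (W₂ : Type) (_ : TopologicalSpace W₂) (_ : ChartedSpace (EuclideanHalfSpace 4) W₂)
      (_ : IsManifold (𝓡∂ 4) ∞ W₂) (_ : CompactSpace W₂) (_ : T2Space W₂) (_ : SecondCountableTopology W₂)
      (D₂ : MultiAttachmentData
        (fun j : Fin n => dualMap D bX bW Ψ col κ δ hκ hκ1 hδ hδ2 (Fin.cast hk.symm (Fin.natAdd m j)))
        (𝓡∂ 4) W₂)
      (b₂ : BoundaryData (𝓡∂ 4) W₂ (𝓡 3))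
      (φ : (BoundaryManifold.boundaryData 3 X₁).carrier ≃ₘ⟮𝓡 3, 𝓡 3⟯ b₂.carrier),
      IsBoundaryGluing (BoundaryManifold.boundaryData 3 X₁) b₂ φ (𝓡 4) M ∧
      HandleAttachingMap.IsMultiAttachment
        (fun j : Fin n => D₁.lift (h (Fin.cast hk.symm (Fin.natAdd m j)))
          (disjoint_range_natAdd_castAdd hk D j)) (𝓡∂ 4) X ∧
      ∀ (y : (BoundaryManifold.boundaryData 3 X₁).carrier) (a : ↥(coresComplement h))
        (ha₁ : (a : B) ∈ coresComplement fun i : Fin m => h (Fin.cast hk.symm (Fin.castAdd n i)))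
        (z : bX.carrier) (hz : D.jA a = bX.incl z),
        (BoundaryManifold.boundaryData 3 X₁).incl y = D₁.jA ⟨a, ha₁⟩ →
        (a : B) ∉ ⋃ j : Fin n, range (h (Fin.cast hk.symm (Fin.natAdd m j))).toFun →
        b₂.incl (φ y) = D₂.jA ⟨bW.incl (Ψ z), incl_mem_coresComplement_dualMap D bX bW Ψ col κ δ hκ
          hκ1 hδ hδ2 (fun j : Fin n => Fin.cast hk.symm (Fin.natAdd m j)) z a hz⟩ := by
  sorry

/-- **NODE T3a (`node_dual_presentation_one`) — one handle, abstract (the brief's T3a).**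
`X = X₁ ∪_q H` (one 2-handle attached to the compact `X₁`, data `D`), `M = X ∪_Ψ W` closed; then
`M = X₁ ∪_φ W'` with `W' = W ∪_{q'} H` attached along the dual map `q' = dualMap D bX bW Ψ col κ δ ()`
(Milnor's dual handle: the belt tube of `H` pushed through `Ψ` and a collar of `∂W`).  This is T3b with
`B := X₁`, `m := 0`, `n := 1` (up to `Unit ≃ Fin 1` and `X₁ ≅ X₁ ∪ ∅`); the induction T3a ⇒ T3b over
`isMultiAttachment_lift_iff_sumElim` is possible but NOT recommended (the seam and the collar change at
every step, so the dual tubes of later handles must be re-expressed); prove T3b directly, simultaneously,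
as T2 did.  Size: included in T3b. [cite: MilnorHCobordism1965, §3] -/
theorem node_dual_presentation_one
    {X₁ : Type} [TopologicalSpace X₁] [T2Space X₁] [SecondCountableTopology X₁] [CompactSpace X₁]
    [ChartedSpace (EuclideanHalfSpace 4) X₁] [IsManifold (𝓡∂ 4) ∞ X₁]
    (q : HandleAttachingMap 3 2 X₁)
    {X : Type} [TopologicalSpace X] [T2Space X] [SecondCountableTopology X] [CompactSpace X]
    [ChartedSpace (EuclideanHalfSpace 4) X] [IsManifold (𝓡∂ 4) ∞ X]
    (D : MultiAttachmentData (fun _ : Unit => q) (𝓡∂ 4) X)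
    {W : Type} [TopologicalSpace W] [T2Space W] [SecondCountableTopology W] [CompactSpace W]
    [ChartedSpace (EuclideanHalfSpace 4) W] [IsManifold (𝓡∂ 4) ∞ W]
    (bX : BoundaryData (𝓡∂ 4) X (𝓡 3)) (bW : BoundaryData (𝓡∂ 4) W (𝓡 3))
    (Ψ : bX.carrier ≃ₘ⟮𝓡 3, 𝓡 3⟯ bW.carrier)
    {M : Type} [TopologicalSpace M] [T2Space M] [SecondCountableTopology M]
    [ChartedSpace (EuclideanSpace ℝ (Fin 4)) M] [IsManifold (𝓡 4) ∞ M]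
    (hglue : IsBoundaryGluing bX bW Ψ (𝓡 4) M) :
    ∃ (col : (BoundaryManifold.boundaryData 3 W).Collar) (κ δ : ℝ) (hκ : 0 < κ) (hκ1 : κ ≤ 1)
      (hδ : 0 < δ) (hδ2 : δ ≤ 1 / 2)
      (W' : Type) (_ : TopologicalSpace W') (_ : ChartedSpace (EuclideanHalfSpace 4) W')
      (_ : IsManifold (𝓡∂ 4) ∞ W') (_ : CompactSpace W') (_ : T2Space W') (_ : SecondCountableTopology W')
      (_ : MultiAttachmentData (fun u : Unit => dualMap D bX bW Ψ col κ δ hκ hκ1 hδ hδ2 u) (𝓡∂ 4) W')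
      (b' : BoundaryData (𝓡∂ 4) W' (𝓡 3))
      (φ : (BoundaryManifold.boundaryData 3 X₁).carrier ≃ₘ⟮𝓡 3, 𝓡 3⟯ b'.carrier),
      IsBoundaryGluing (BoundaryManifold.boundaryData 3 X₁) b' φ (𝓡 4) M := by
  sorry

end DualPresentation

/-! ## §2 Nodes T3c — the dual link is a Lefschetz link (after isotopies and a page rotation) -/

section DualLink

variable (g : ℕ)

/-- The page clause of `ModelsOnFibred` for the data `(h, D, bX, Ψ)`: `Ψ` preserves page angles on the
base part of the seam. [cite: EtnyreFuller2006, Thm. 1 (proof, p. 8)] -/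
def PageClause {l : List ((Fin g ⊕ Fin g → ℤ) × Bool)} {X : Type} [TopologicalSpace X]
    [ChartedSpace (EuclideanHalfSpace 4) X] (h : Fin l.length → HandleAttachingMap 3 2 (Base g))
    (D : MultiAttachmentData h (𝓡∂ 4) X) (bX : BoundaryData (𝓡∂ 4) X (𝓡 3))
    (Ψ : bX.carrier ≃ₘ⟮𝓡 3, 𝓡 3⟯ (bBase g).carrier) : Prop :=
  ∀ (y : bX.carrier) (a : ↥(coresComplement h)), bX.incl y = D.jA a →
    ∃ c : ℝ, 0 < c ∧ w g ((bBase g).incl (Ψ y)).1 = (c : ℂ) * w g (a : Base g).1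

/-- **NODE T3c-1 (`node_belt_isotopic_pushoff`) — in `∂X`, the framed belt knot of a Lefschetz handle
is (isotopic to) the vanishing cycle in a neighbouring page, with universally transformed twisting.**
For a Lefschetz link `h` of word `l` over `Base g`, `X = Base g ∪_{h̄}` (data `D`) and a small `η > 0`:
there are page curves `K j ⊂ page (pageDir |l| j · e^{-iη})` off all cores, framings `ν j` in
`∂ Base g` with page twisting `σ₀ · t_j` (`t_j = ∓1` the twisting of letter `j`; `σ₀ = ±1` UNIVERSAL,
expected `σ₀ = −1`: the surgery along the dual framed knot undoes the surgery along `(K_j, t_j)`), the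
SAME shadow `(l.get j).1`, and a link isotopy IN `∂X` from the belt circles to `D.jA ∘ K j` carrying
the belt framings (`attachingFraming` of the belt maps) to framings homotopic to `d(jA)(ν j)`.
Proof idea (Kosinski's model): the torus of radius `r` around the belt circle of handle `j` is glued
(`x ∼ h̄ α(x)`, `|α(x)_λ|² = 1 − |x_λ|²`) to the torus of radius `r` around `K_j` with meridian and
longitude exchanged; slide the belt circle to a longitude of that torus inside `jB_j(∂D⁴ ∖ S)`, then,
through `jA ∘ h̄_j` and the tube coordinates (`HandleAttachingMapOfTube.lean`), to the page push-off
(`IsLefschetzLink.mem_page`: `K_j` is a page curve, so its push-off in the angle direction is a page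
curve); framings by the longitude bookkeeping of `…KasLoops.lean`; shadows by homotopy invariance
(`shadow_eq_of_homotopic`-type lemmas of `…PageInvariance.lean`).  Size L (≈ 800–1500 lines).
[cite: GompfStipsicz1999, §8.2 pp. 289–291; Kosinski1993, VI §6] -/
theorem node_belt_isotopic_pushoff (l : List ((Fin g ⊕ Fin g → ℤ) × Bool))
    (h : Fin l.length → HandleAttachingMap 3 2 (Base g)) (hlink : IsLefschetzLink g l h)
    {X : Type} [TopologicalSpace X] [T2Space X] [SecondCountableTopology X] [CompactSpace X]
    [ChartedSpace (EuclideanHalfSpace 4) X] [IsManifold (𝓡∂ 4) ∞ X]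
    (D : MultiAttachmentData h (𝓡∂ 4) X) (η : ℝ) (hη : 0 < η) (hηπ : η * l.length < Real.pi) :
    ∃ (σ₀ : ℤ) (K : Fin l.length → sphere (0 : EuclideanSpace ℝ (Fin 2)) 1 → Base g)
      (ν : Fin l.length → sphere (0 : EuclideanSpace ℝ (Fin 2)) 1 → EuclideanSpace ℝ (Fin 4))
      (hKc : ∀ j, Continuous (K j)) (hK : ∀ j θ, K j θ ∈ coresComplement h)
      (Φ : LinkIsotopyInBoundary (fun j => (beltMap D j).attachingCircle)
        (fun j θ => D.jA ⟨K j θ, hK j θ⟩))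
      (νt : Fin l.length → ℝ → sphere (0 : EuclideanSpace ℝ (Fin 2)) 1 → EuclideanSpace ℝ (Fin 4)),
      (σ₀ = 1 ∨ σ₀ = -1) ∧
      (∀ (j : Fin l.length) θ,
        K j θ ∈ page g (pageDir l.length j * Complex.exp (-(η : ℂ) * Complex.I))) ∧
      (∀ j, IsBoundaryKnot (K j)) ∧ (∀ j, IsKnotFraming (K j) (ν j)) ∧
      (∀ j, shadow g (K j) (hKc j) = (l.get j).1) ∧
      (∀ j, pageTwisting g (K j) (ν j) = σ₀ * (if (l.get j).2 then -1 else 1)) ∧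
      (∀ j, IsFramingAlong (Φ.isotopy j) (beltMap D j).attachingFraming (νt j)) ∧
      (∀ j, FramingHomotopic (fun θ => D.jA ⟨K j θ, hK j θ⟩) (νt j 1)
        (fun θ => mfderiv (𝓡∂ 4) (𝓡∂ 4) (fun a : ↥(coresComplement h) => D.jA a)
          ⟨K j θ, hK j θ⟩ (ν j θ))) := by
  sorry

/-- **NODE T3c-2 (`node_seam_transport`) — the page clause transports framed page knots.**  For the
data `(h, D, bX, Ψ)` of a fibred model (page clause `PageClause`) there is a GLOBAL sign `s₀ = ±1`
(the orientation character of the fibred open embedding `Ψ ∘ jA : ∂ Base g ∖ ⋃ Kᵢ → ∂ Base g`) such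
that: every finite family of framed page knots `(K i ⊂ page (c i), ν i)` at distinct directions, off the
cores, read in `∂X` through `jA` (lifts `z i` of the points, `u i` of the framing vectors along
`bX.incl`) and pushed by `Ψ` into `∂ Base g`, is link-isotopic in `∂ Base g` — each component inside
its own extended page `{q | w q ∈ ℝ_{>0} · c i}`, so the components never meet — to framed knots
`(K' i ⊂ page (c i), ν' i)` with `shadow (K' i) = A i (shadow (K i))` for automorphisms `A i` of `ℤ^{2g}`
and `pageTwisting (K' i) (ν' i) = s₀ · pageTwisting (K i) (ν i)`, the pushed framing being carried to a
framing homotopic to `ν' i`.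
Proof idea: `w (Ψ y) = c(y) w(a)`, `c > 0` smooth (quotient of smooth non-vanishing functions), so the
image knot lies in the extended page and is brought back to `‖cx‖² < 4`, `|w| = 1/2` by the radial
flow of the binding region (the vertical/horizontal fields of `…PageRotationField.lean` have
`d rho = 0`; here one needs the complementary field moving `‖cx‖²` at fixed `arg w` inside `{rho = 1/4}`);
`A i :=` the action on `H₁(page) = ℤ^{2g}` of `Ψ ∘ jA` restricted to the closed fibre at angle `c i`
(an embedding of a compact connected surface with connected boundary into itself, boundary to boundary,
hence a diffeomorphism; it jumps by the Picard–Lefschetz twist across a critical angle, so it depends on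
`i`); the twisting identity from `pageTwisting_comp_ambientIsotopy`-type invariance plus the sign `s₀`
of `Ψ ∘ jA` on the orientation of `∂ Base g`.  Size L (≈ 1000–1500 lines).
[cite: Baykur2006, Thm. 5.1 (proof, p. 13); EtnyreFuller2006, Thm. 1 (proof, p. 8)] -/
theorem node_seam_transport (l : List ((Fin g ⊕ Fin g → ℤ) × Bool))
    (h : Fin l.length → HandleAttachingMap 3 2 (Base g)) (hlink : IsLefschetzLink g l h)
    {X : Type} [TopologicalSpace X] [T2Space X] [SecondCountableTopology X] [CompactSpace X]
    [ChartedSpace (EuclideanHalfSpace 4) X] [IsManifold (𝓡∂ 4) ∞ X]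
    (D : MultiAttachmentData h (𝓡∂ 4) X) (bX : BoundaryData (𝓡∂ 4) X (𝓡 3))
    (Ψ : bX.carrier ≃ₘ⟮𝓡 3, 𝓡 3⟯ (bBase g).carrier) (hpage : PageClause g h D bX Ψ) :
    ∃ s₀ : ℤ, (s₀ = 1 ∨ s₀ = -1) ∧
      ∀ (ι : Type) [Finite ι] (c : ι → ℂ) (_ : ∀ i, ‖c i‖ = 1) (_ : Injective c)
        (K : ι → sphere (0 : EuclideanSpace ℝ (Fin 2)) 1 → Base g)
        (ν : ι → sphere (0 : EuclideanSpace ℝ (Fin 2)) 1 → EuclideanSpace ℝ (Fin 4))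
        (hKc : ∀ i, Continuous (K i)) (hK : ∀ i θ, K i θ ∈ coresComplement h)
        (_ : ∀ i θ, K i θ ∈ page g (c i)) (_ : ∀ i, IsBoundaryKnot (K i))
        (_ : ∀ i, IsKnotFraming (K i) (ν i))
        (z : ι → sphere (0 : EuclideanSpace ℝ (Fin 2)) 1 → bX.carrier)
        (_ : ∀ i θ, bX.incl (z i θ) = D.jA ⟨K i θ, hK i θ⟩)
        (u : ι → sphere (0 : EuclideanSpace ℝ (Fin 2)) 1 → EuclideanSpace ℝ (Fin 3))
        (_ : ∀ i θ, mfderiv (𝓡 3) (𝓡∂ 4) bX.incl (z i θ) (u i θ) =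
          mfderiv (𝓡∂ 4) (𝓡∂ 4) (fun a : ↥(coresComplement h) => D.jA a) ⟨K i θ, hK i θ⟩ (ν i θ)),
        ∃ (A : ι → ((Fin g ⊕ Fin g → ℤ) ≃ₗ[ℤ] (Fin g ⊕ Fin g → ℤ)))
          (K' : ι → sphere (0 : EuclideanSpace ℝ (Fin 2)) 1 → Base g)
          (ν' : ι → sphere (0 : EuclideanSpace ℝ (Fin 2)) 1 → EuclideanSpace ℝ (Fin 4))
          (hK'c : ∀ i, Continuous (K' i))
          (Φ : LinkIsotopyInBoundary (fun i θ => ((bBase g).incl (Ψ (z i θ)) : Base g)) K')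
          (νt : ι → ℝ → sphere (0 : EuclideanSpace ℝ (Fin 2)) 1 → EuclideanSpace ℝ (Fin 4)),
          (∀ i θ, K' i θ ∈ page g (c i)) ∧ (∀ i, IsKnotFraming (K' i) (ν' i)) ∧
          (∀ i, shadow g (K' i) (hK'c i) = A i (shadow g (K i) (hKc i))) ∧
          (∀ i, pageTwisting g (K' i) (ν' i) = s₀ * pageTwisting g (K i) (ν i)) ∧
          (∀ i, IsFramingAlong (Φ.isotopy i)
            (fun θ => mfderiv (𝓡 3) (𝓡∂ 4) (fun y => ((bBase g).incl (Ψ y) : Base g)) (z i θ) (u i θ))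
            (νt i)) ∧
          (∀ i, FramingHomotopic (K' i) (νt i 1) (ν' i)) := by
  sorry

/-- **NODE T3c-3 (`node_dualLink_pageLink`) — ISO + TUBE: every multi-attachment along the dual maps
is a multi-attachment along a Lefschetz link AT the directions `pageDir (m+n) (m+j) e^{-iη}`, realising
the dual word.**  From T3c-1 (belt framed knots ≃ page push-offs in `∂X`, with `σ₀` and the same
shadows), the identification of the dual framed knots (`attachingCircle_dualMap`;
`TubeAttachData.attachingMap_tubeArcPt` + `attachingFraming_eq_mfderiv_comp_tubeArcPt`: the dual framing
is `κ · d(incl ∘ Ψ)(fibre direction of the belt tube)`), the transport of link isotopies of `∂X` to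
`∂ Base g` along the seam diffeomorphism (≈ 150 lines, new), T3c-2 (fibred straightening, `A j`, `s₀`),
TUBE (`exists_handleAttachingMap_of_isKnotFraming_holds`, PROVED; `isOrientable_base`; ranges inside the
pairwise disjoint extended pages) and ISO (`isMultiAttachment_of_linkIsotopyInBoundary_holds`, PROVED).
The word realised is `dualWord N A flip` with `flip := (s₀ σ₀ = −1)`.  Size M (≈ 500–800 lines on top
of T3c-1/T3c-2). [cite: Kosinski1993, VI §6 and VIII proof of (1.2); Baykur2006, Thm. 5.1 (proof)] -/
theorem node_dualLink_pageLink (P N : List ((Fin g ⊕ Fin g → ℤ) × Bool))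
    (h : Fin (P ++ N).length → HandleAttachingMap 3 2 (Base g)) (hlink : IsLefschetzLink g (P ++ N) h)
    {X : Type} [TopologicalSpace X] [T2Space X] [SecondCountableTopology X] [CompactSpace X]
    [ChartedSpace (EuclideanHalfSpace 4) X] [IsManifold (𝓡∂ 4) ∞ X]
    (D : MultiAttachmentData h (𝓡∂ 4) X) (bX : BoundaryData (𝓡∂ 4) X (𝓡 3))
    (Ψ : bX.carrier ≃ₘ⟮𝓡 3, 𝓡 3⟯ (bBase g).carrier) (hpage : PageClause g h D bX Ψ)
    (col : (BoundaryManifold.boundaryData 3 (Base g)).Collar) (κ δ : ℝ) (hκ : 0 < κ) (hκ1 : κ ≤ 1)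
    (hδ : 0 < δ) (hδ2 : δ ≤ 1 / 2) :
    ∃ (A : Fin N.length → ((Fin g ⊕ Fin g → ℤ) ≃ₗ[ℤ] (Fin g ⊕ Fin g → ℤ))) (flip : Bool)
      (dir : Fin (dualWord N A flip).length → ℂ)
      (h' : Fin (dualWord N A flip).length → HandleAttachingMap 3 2 (Base g)),
      IsLefschetzLinkAt g (dualWord N A flip) dir h' ∧ ClockwiseDirs dir ∧
      ∀ (W₂ : Type) [TopologicalSpace W₂] [ChartedSpace (EuclideanHalfSpace 4) W₂] [IsManifold (𝓡∂ 4) ∞ W₂],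
        HandleAttachingMap.IsMultiAttachment
          (fun j : Fin N.length => dualMap D bX (bBase g) Ψ col κ δ hκ hκ1 hδ hδ2
            (Fin.cast List.length_append.symm (Fin.natAdd P.length j))) (𝓡∂ 4) W₂ →
        HandleAttachingMap.IsMultiAttachment h' (𝓡∂ 4) W₂ := by
  sorry

/-- **NODE T3c-4 (`node_pageRotation_of_clockwiseDirs`) — page rotation of the base to prescribed
clockwise directions.**  For unit directions `dir i` in clockwise order within one turn there is an
ambient isotopy of `Base g` preserving `rho`, FIBRED (pages to pages, simultaneously), taking
`page (dir i)` into `page (pageDir n i)` at time `1`.  W1's `helper_exists_pageRotation` (being landed)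
is the case `dir i = pageDir (m + n) i`, `i < m`; the proof (flow of `rotFieldA g a` for a profile `a`
realising an orientation-preserving circle isotopy `arg (dir i) ↦ arg (pageDir n i)`, ODE uniqueness
for fibredness) is the same.  Size L (≈ 600–900 lines, or ≈ 200 on top of W1's files if W1 proves
the general schedule). [cite: Baykur2006, Thm. 5.1 (proof)] -/
theorem node_pageRotation_of_clockwiseDirs (n : ℕ) (dir : Fin n → ℂ) (hdir : ∀ i, ‖dir i‖ = 1)
    (hcw : ClockwiseDirs dir) :
    ∃ R : AmbientIsotopy (𝓡∂ 4) (Base g),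
      (∀ (t : ℝ) (x : Base g), rho g (R.toFun t x).1 = rho g x.1) ∧
      (∀ (t : ℝ) (c : ℂ), ‖c‖ = 1 → ∃ c' : ℂ, ‖c'‖ = 1 ∧
        ∀ x : Base g, x ∈ page g c → R.toFun t x ∈ page g c') ∧
      (∀ (i : Fin n) (x : Base g), x ∈ page g (dir i) → R.toFun 1 x ∈ page g (pageDir n i)) := by
  sorry

/-- **NODE T3c-5 (`node_isLefschetzLink_transport_at`) — transport of a link at directions `dir`
along a fibred page rotation ending at the standard directions gives a Lefschetz link.**  W2's
`helper_isLefschetzLink_prefix_transport` is the special case `dir i = pageDir (m + n) i`; same proof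
(`pairwise_disjoint_range_transport`, `shadow_comp_ambientIsotopy`, `pageTwisting_transport_eq_of_fibred`,
`attachingCircle_transport`).  Size S (≈ 250 lines). [cite: EtnyreFuller2006, §2] -/
theorem node_isLefschetzLink_transport_at (l : List ((Fin g ⊕ Fin g → ℤ) × Bool))
    (dir : Fin l.length → ℂ) (h' : Fin l.length → HandleAttachingMap 3 2 (Base g))
    (hl : IsLefschetzLinkAt g l dir h') (R : AmbientIsotopy (𝓡∂ 4) (Base g))
    (hfib : ∀ (t : ℝ) (c : ℂ), ‖c‖ = 1 → ∃ c' : ℂ, ‖c'‖ = 1 ∧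
      ∀ x : Base g, x ∈ page g c → R.toFun t x ∈ page g c')
    (hend : ∀ (i : Fin l.length) (x : Base g), x ∈ page g (dir i) →
      R.toFun 1 x ∈ page g (pageDir l.length i)) :
    IsLefschetzLink g l (fun i => (h' i).transport (R.toDiffeomorph 1)) := by
  sorry

end DualLink

/-! ## §3 The T3 target, PROVED from the nodes -/

section Target

/-- The boundary of the base is non-empty. [folklore] -/
theorem boundary_base_nonempty (g : ℕ) : ((𝓡∂ 4).boundary (Base g)).Nonempty := by
  obtain ⟨y₀⟩ := nonempty_bBase_carrier g
  exact ⟨(bBase g).incl y₀, (bBase g).incl_mem_boundary y₀⟩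

/-- **T3 (`isLefschetzHandlebody_complement_of_nodes`) — the complement piece is the cap with the dual
handles, a Lefschetz handlebody of the dual word; PROVED from the nodes T3b, T3c-3, T3c-4, T3c-5.**
From `ModelsOnFibred M g (P ++ N)`: the Lefschetz link `h`, the sub-handlebody `X₁ = Base g ∪ (prefix)`
with data `D₁` (shape of `helper_exists_complement_of_split`, so T1 plugs in unchanged), a compact `W₂`,
`b₂`, `φ` with `M = X₁ ∪_φ W₂`, AND `IsLefschetzHandlebody g (dualWord N A flip) W₂` for some letterwise
automorphisms `A` of `ℤ^{2g}` and some `flip : Bool` (see the module docstring for why `A`, `flip` are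
existential).  No sign hypothesis on `N` is needed. [cite: Baykur2006, Thm. 5.1 (proof, pp. 13–14)] -/
theorem isLefschetzHandlebody_complement_of_nodes
    (M : Type) [TopologicalSpace M] [T2Space M] [SecondCountableTopology M]
    [ChartedSpace (EuclideanSpace ℝ (Fin 4)) M] [IsManifold (𝓡 4) ∞ M]
    (g : ℕ) (P N : List ((Fin g ⊕ Fin g → ℤ) × Bool)) (hM : ModelsOnFibred M g (P ++ N)) :
    ∃ (h : Fin (P ++ N).length → HandleAttachingMap 3 2 (Base g))
      (X₁ : Type) (_ : TopologicalSpace X₁) (_ : T2Space X₁) (_ : SecondCountableTopology X₁)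
      (_ : CompactSpace X₁) (_ : ChartedSpace (EuclideanHalfSpace 4) X₁) (_ : IsManifold (𝓡∂ 4) ∞ X₁)
      (_ : MultiAttachmentData
        (fun i : Fin P.length => h (Fin.cast List.length_append.symm (Fin.castAdd N.length i)))
        (𝓡∂ 4) X₁)
      (W₂ : Type) (_ : TopologicalSpace W₂) (_ : ChartedSpace (EuclideanHalfSpace 4) W₂)
      (_ : IsManifold (𝓡∂ 4) ∞ W₂) (_ : CompactSpace W₂) (_ : T2Space W₂)
      (_ : SecondCountableTopology W₂)
      (b₂ : BoundaryData (𝓡∂ 4) W₂ (𝓡 3))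
      (φ : (BoundaryManifold.boundaryData 3 X₁).carrier ≃ₘ⟮𝓡 3, 𝓡 3⟯ b₂.carrier),
      IsLefschetzLink g (P ++ N) h ∧
      IsBoundaryGluing (BoundaryManifold.boundaryData 3 X₁) b₂ φ (𝓡 4) M ∧
      ∃ (A : Fin N.length → ((Fin g ⊕ Fin g → ℤ) ≃ₗ[ℤ] (Fin g ⊕ Fin g → ℤ))) (flip : Bool),
        IsLefschetzHandlebody g (dualWord N A flip) W₂ := by
  obtain ⟨X, _, _, _, _, _, _, h, Dm, bX, Ψ, hlink, hglue, hpage⟩ := hM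
  -- T3b: the dual presentation
  obtain ⟨X₁, _, _, _, _, _, _, D₁, col, κ, δ, hκ, hκ1, hδ, hδ2, W₂, _, _, _, _, _, _, D₂, b₂, φ,
      hglue₂, -, -⟩ :=
    node_dual_presentation P.length N.length (List.length_append (as := P) (bs := N)) h Dm bX (bBase g)
      Ψ hglue (boundary_base_nonempty g)
  -- T3c-3: the dual link is a Lefschetz link at clockwise directions
  obtain ⟨A, flip, dir, h', hlat, hcw, hiso⟩ :=
    node_dualLink_pageLink g P N h hlink Dm bX Ψ hpage col κ δ hκ hκ1 hδ hδ2
  have hW₂ : HandleAttachingMap.IsMultiAttachment h' (𝓡∂ 4) W₂ := hiso W₂ D₂.isMultiAttachment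
  -- T3c-4/5: rotate the pages to the standard directions and transport
  obtain ⟨R, -, hfib, hend⟩ := node_pageRotation_of_clockwiseDirs g _ dir hlat.norm_dir hcw
  have hlink' := node_isLefschetzLink_transport_at g (dualWord N A flip) dir h' hlat R hfib hend
  exact ⟨h, X₁, _, inferInstance, inferInstance, inferInstance, _, inferInstance, D₁, W₂, _, _,
    inferInstance, inferInstance, inferInstance, inferInstance, b₂, φ, hlink, hglue₂, A, flip,
    ⟨_, hlink', hW₂.transport (R.toDiffeomorph 1)⟩⟩

/-- **Corollary (the sorted case of NF6).**  If the suffix word `N` is all-negative with non-zero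
classes, the dual word is UNIFORMLY signed (`xor flip false = flip`) with non-zero classes: `W₂` is a
Lefschetz handlebody of an all-positive word (`flip = true`, Baykur's "the NALF on `X₋` is a PALF on
`−X₋`", the case where the cap's complex orientation is opposite to `M`'s) or of an all-negative word
(`flip = false`, the other orientation character of `Ψ`).  [cite: Baykur2006, Thm. 5.1 (proof, p. 13)] -/
theorem isLefschetzHandlebody_complement_uniform_of_nodes
    (M : Type) [TopologicalSpace M] [T2Space M] [SecondCountableTopology M]
    [ChartedSpace (EuclideanSpace ℝ (Fin 4)) M] [IsManifold (𝓡 4) ∞ M]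
    (g : ℕ) (P N : List ((Fin g ⊕ Fin g → ℤ) × Bool)) (hM : ModelsOnFibred M g (P ++ N))
    (hN : ∀ x ∈ N, x.2 = false) (hN0 : ∀ x ∈ N, x.1 ≠ 0) :
    ∃ (h : Fin (P ++ N).length → HandleAttachingMap 3 2 (Base g))
      (X₁ : Type) (_ : TopologicalSpace X₁) (_ : T2Space X₁) (_ : SecondCountableTopology X₁)
      (_ : CompactSpace X₁) (_ : ChartedSpace (EuclideanHalfSpace 4) X₁) (_ : IsManifold (𝓡∂ 4) ∞ X₁)
      (_ : MultiAttachmentData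
        (fun i : Fin P.length => h (Fin.cast List.length_append.symm (Fin.castAdd N.length i)))
        (𝓡∂ 4) X₁)
      (W₂ : Type) (_ : TopologicalSpace W₂) (_ : ChartedSpace (EuclideanHalfSpace 4) W₂)
      (_ : IsManifold (𝓡∂ 4) ∞ W₂) (_ : CompactSpace W₂) (_ : T2Space W₂)
      (_ : SecondCountableTopology W₂)
      (b₂ : BoundaryData (𝓡∂ 4) W₂ (𝓡 3))
      (φ : (BoundaryManifold.boundaryData 3 X₁).carrier ≃ₘ⟮𝓡 3, 𝓡 3⟯ b₂.carrier),
      IsLefschetzLink g (P ++ N) h ∧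
      IsBoundaryGluing (BoundaryManifold.boundaryData 3 X₁) b₂ φ (𝓡 4) M ∧
      ∃ (N' : List ((Fin g ⊕ Fin g → ℤ) × Bool)) (s : Bool), N'.length = N.length ∧
        (∀ x ∈ N', x.2 = s) ∧ (∀ x ∈ N', x.1 ≠ 0) ∧ IsLefschetzHandlebody g N' W₂ := by
  obtain ⟨h, X₁, _, _, _, _, _, _, D₁, W₂, _, _, _, _, _, _, b₂, φ, hlink, hglue₂, A, flip, hW₂⟩ :=
    isLefschetzHandlebody_complement_of_nodes M g P N hM
  refine ⟨h, X₁, _, inferInstance, inferInstance, inferInstance, _, inferInstance, D₁, W₂, _, _,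
    inferInstance, inferInstance, inferInstance, inferInstance, b₂, φ, hlink, hglue₂,
    dualWord N A flip, flip, length_dualWord N A flip, ?_, dualWord_forall_ne_zero N A flip hN0, hW₂⟩
  simpa using dualWord_forall_sign N A flip false hN

end Target

end Summit.SmoothPoincare4.SmoothPoincare4.Theorems.AcyclicBisectionExists.ModpBraidOrbits

end
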